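import Mathlib
import HarnessLib

/-!
# Route `IsogenyRedei` — support item `SliceFrame` (stmt-Parity-14953): the negative Pell count

Elementary input for the large-`r` range of the squarefree sieve inside `SliceFrame`
(Estermann 1931): for every `D ≥ 0` the positive solutions `n` of the negative Pell equation
`n² + 1 = D·r²` grow geometrically — two solutions `1 ≤ n < n'` satisfy `3n ≤ n'`
(`three_mul_le_of_negPell`) — so at most `⌊log₃ y⌋ + 1` of them lie in `[1, y]`
(`card_negPell_le`).  Proof: with `d = √D`, `(n' + r'd)/(n + rd) = U + Vd` is a unit of norm `+1`
with `U, V ∈ ℤ`, hence `U ≥ 2`, `V ≥ 1` and `U + Vd > 3`; while `2n < n + rd` and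
`n' + r'd < 2n' + 1`.  No Mathlib `Pell` API is needed.
-/

namespace Summit.Parity.BatemanHorn.Theorems.SliceFrame

/-- If `n² + 1 = D r²` has a solution with `n ≥ 1` then `D ≥ 2`. [folklore] -/
theorem two_le_of_negPell {D n r : ℕ} (hn : n ^ 2 + 1 = D * r ^ 2) (h1 : 1 ≤ n) : 2 ≤ D := by
  rcases Nat.lt_or_ge D 2 with hD | hD
  · interval_cases D
    · simp at hn
    · rw [one_mul] at hn
      have h2 : n ^ 2 < r ^ 2 := by omega
      have h3 : r ^ 2 < (n + 1) ^ 2 := by nlinarith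
      have h4 : n < r := lt_of_pow_lt_pow_left₀ 2 (Nat.zero_le _) h2
      have h5 : r < n + 1 := lt_of_pow_lt_pow_left₀ 2 (Nat.zero_le _) h3
      omega
  · exact hD

/-- **Geometric growth of negative Pell solutions.** If `n² + 1 = D r²` and `n'² + 1 = D r'²`
with `1 ≤ n < n'`, then `3 n ≤ n'`. [folklore] -/
theorem three_mul_le_of_negPell {D n r n' r' : ℕ} (hn : n ^ 2 + 1 = D * r ^ 2)
    (hn' : n' ^ 2 + 1 = D * r' ^ 2) (h1 : 1 ≤ n) (hlt : n < n') : 3 * n ≤ n' := by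
  have hD2 : 2 ≤ D := two_le_of_negPell hn h1
  -- real square root of `D`
  set d : ℝ := Real.sqrt D with hd_def
  have hD0 : (0 : ℝ) ≤ D := Nat.cast_nonneg D
  have hdd : d * d = D := Real.mul_self_sqrt hD0
  have hd1 : 1 < d := by
    rw [hd_def, show (1 : ℝ) = Real.sqrt 1 from Real.sqrt_one.symm]
    exact Real.sqrt_lt_sqrt zero_le_one (by exact_mod_cast hD2)
  have hd0 : 0 < d := zero_lt_one.trans hd1
  -- the equations over `ℝ` and `ℤ`
  have hnR : (n : ℝ) ^ 2 + 1 = D * r ^ 2 := by exact_mod_cast hn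
  have hn'R : (n' : ℝ) ^ 2 + 1 = D * r' ^ 2 := by exact_mod_cast hn'
  have hnZ : (n : ℤ) ^ 2 + 1 = D * r ^ 2 := by exact_mod_cast hn
  have hn'Z : (n' : ℤ) ^ 2 + 1 = D * r' ^ 2 := by exact_mod_cast hn'
  have hn0 : (0 : ℝ) < n := by exact_mod_cast h1
  have hnn' : (n : ℝ) < n' := by exact_mod_cast hlt
  have hr0 : (0 : ℝ) ≤ r := Nat.cast_nonneg r
  have hr'0 : (0 : ℝ) ≤ r' := Nat.cast_nonneg r'
  -- `rd > n`, `r'd < n' + 1`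
  have hrd : (n : ℝ) < r * d := by
    have h : (n : ℝ) ^ 2 < (r * d) ^ 2 := by nlinarith
    exact lt_of_pow_lt_pow_left₀ 2 (mul_nonneg hr0 hd0.le) h
  have hr'd : (r' : ℝ) * d < n' + 1 := by
    have h : ((r' : ℝ) * d) ^ 2 < ((n' : ℝ) + 1) ^ 2 := by nlinarith
    exact lt_of_pow_lt_pow_left₀ 2 (by positivity) h
  -- `r < r'`
  have hrr' : (r : ℝ) ≤ r' := by
    have h : (r : ℝ) ^ 2 ≤ (r' : ℝ) ^ 2 := by nlinarith
    exact le_of_pow_le_pow_left₀ two_ne_zero hr'0 h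
  -- the unit `U + V d = (n' + r' d)/(n + r d)`
  set U : ℤ := (D : ℤ) * r * r' - n * n' with hU
  set V : ℤ := (n' : ℤ) * r - n * r' with hV
  have hUV : U ^ 2 - D * V ^ 2 = 1 := by
    simp only [hU, hV]
    linear_combination ((n' : ℤ) ^ 2 - D * r' ^ 2) * hnZ - hn'Z
  have hUVR : (U : ℝ) ^ 2 - D * (V : ℝ) ^ 2 = 1 := by exact_mod_cast hUV
  have hplus : ((U : ℝ) + V * d) * (n + r * d) = n' + r' * d := by
    simp only [hU, hV]
    push_cast
    linear_combination (-(n' : ℝ) - r' * d) * hnR + ((n' : ℝ) * r ^ 2 - n * r * r') * hdd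
  have hprod : ((U : ℝ) + V * d) * ((U : ℝ) - V * d) = 1 := by
    linear_combination hUVR - (V : ℝ) ^ 2 * hdd
  have hα : (0 : ℝ) < n + r * d := by positivity
  have hgt : (1 : ℝ) < (U : ℝ) + V * d := by
    have h2 : (n : ℝ) + r * d < n' + r' * d := by nlinarith
    rw [← hplus] at h2
    by_contra h
    push Not at h
    nlinarith
  have hpos : (0 : ℝ) < (U : ℝ) + V * d := zero_lt_one.trans hgt
  have hconj_pos : (0 : ℝ) < (U : ℝ) - V * d := by
    by_contra h
    push Not at h
    nlinarith
  have hconj_lt : (U : ℝ) - V * d < 1 := by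
    by_contra h
    push Not at h
    nlinarith
  -- `V ≥ 1`, `U ≥ 2`
  have hV1 : (1 : ℤ) ≤ V := by
    have h : (0 : ℝ) < V * d := by linarith
    have h' : (0 : ℝ) < V := pos_of_mul_pos_left h hd0.le
    have h'' : (0 : ℤ) < V := by exact_mod_cast h'
    omega
  have hU2 : (2 : ℤ) ≤ U := by
    have h : (0 : ℝ) < U := by linarith
    have h' : (0 : ℤ) < U := by exact_mod_cast h
    have hD2Z : (2 : ℤ) ≤ D := by exact_mod_cast hD2
    nlinarith
  have hV1R : (1 : ℝ) ≤ V := by exact_mod_cast hV1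
  have hU2R : (2 : ℝ) ≤ U := by exact_mod_cast hU2
  have hunit : (3 : ℝ) < (U : ℝ) + V * d := by nlinarith
  -- combine: `6 n < 2 n' + 1`
  have hfin : (6 : ℝ) * n < 2 * n' + 1 := by
    have h1' : 3 * ((n : ℝ) + r * d) < n' + r' * d := by
      rw [← hplus]
      exact mul_lt_mul_of_pos_right hunit hα
    linarith
  have hfinN : 6 * n < 2 * n' + 1 := by exact_mod_cast hfin
  omega

open Classical in
/-- **At most `⌊log₃ y⌋ + 1` solutions up to `y`.** For every `D` and `y`, the number of
`n ∈ [1, y]` with `n² + 1 = D r²` for some `r` is at most `Nat.log 3 y + 1`. [folklore] -/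
theorem card_negPell_le (D y : ℕ) :
    ((Finset.Icc 1 y).filter (fun n : ℕ => ∃ r : ℕ, n ^ 2 + 1 = D * r ^ 2)).card
      ≤ Nat.log 3 y + 1 := by
  set S := (Finset.Icc 1 y).filter (fun n : ℕ => ∃ r : ℕ, n ^ 2 + 1 = D * r ^ 2) with hS
  have hinj : Set.InjOn (fun n : ℕ => Nat.log 3 n) S := by
    intro a ha b hb hab
    simp only [hS, Finset.coe_filter, Finset.mem_Icc, Set.mem_setOf_eq] at ha hb
    obtain ⟨⟨ha1, -⟩, ra, hra⟩ := ha
    obtain ⟨⟨hb1, -⟩, rb, hrb⟩ := hb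
    simp only at hab
    by_contra hne
    rcases Nat.lt_or_gt_of_ne hne with h | h
    · have h3 := three_mul_le_of_negPell hra hrb ha1 h
      have : Nat.log 3 a + 1 ≤ Nat.log 3 b := by
        calc Nat.log 3 a + 1 = Nat.log 3 (a * 3) := (Nat.log_mul_base (by norm_num) (by omega)).symm
          _ ≤ Nat.log 3 b := Nat.log_mono_right (by omega)
      omega
    · have h3 := three_mul_le_of_negPell hrb hra hb1 h
      have : Nat.log 3 b + 1 ≤ Nat.log 3 a := by
        calc Nat.log 3 b + 1 = Nat.log 3 (b * 3) := (Nat.log_mul_base (by norm_num) (by omega)).symm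
          _ ≤ Nat.log 3 a := Nat.log_mono_right (by omega)
      omega
  have hmaps : Set.MapsTo (fun n : ℕ => Nat.log 3 n) S (Finset.range (Nat.log 3 y + 1)) := by
    intro n hn
    simp only [hS, Finset.coe_filter, Finset.mem_Icc, Set.mem_setOf_eq] at hn
    simp only [Finset.coe_range, Set.mem_Iio]
    exact Nat.lt_succ_of_le (Nat.log_mono_right hn.1.2)
  calc S.card ≤ (Finset.range (Nat.log 3 y + 1)).card := Finset.card_le_card_of_injOn _ hmaps hinj
    _ = Nat.log 3 y + 1 := Finset.card_range _

end Summit.Parity.BatemanHorn.Theorems.SliceFrame
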